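import Literature.NumberTheory.EllipticCurves.ZpExtension
import Literature.NumberTheory.GaloisRepresentations.InducedGaloisRep
import HarnessLib

set_option autoImplicit false

/-!
# Restriction (base change) of a `ℤ_p`-extension along a finite extension `L/K`, and its
# surjectivity for `[L : K] = 2`, `p` odd — `K_∞ ↦ L·K_∞`

Topic `Literature/NumberTheory/EllipticCurves` (companion of `ZpExtension.lean`). For a `ℤ_p`-extension
`κ : Γ_K →ₜ* ℤ_p` of a number field `K` and a finite extension `L/K`, the composite
`κ ∘ res : Γ_L → Γ_K → ℤ_p` (`absGaloisRestrict K L`) cuts out `L·K_∞/L`; it is again a `ℤ_p`-extension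
(i.e. SURJECTIVE) iff `L ∩ K_∞ = K`, which holds whenever `[L : K]` is prime to `p` — here proved for the
case the BSD programme needs, `[L : K] = 2` and `p ≠ 2` (a quadratic field `L = K·K_CM` over a Heegner field
`K = K′`, the anticyclotomic `ℤ_p`-extension of `K′` lifted to the biquadratic CM field; route
`BiquadraticEisensteinDescent`, crux stmt-BirchSwinnertonDyer-21341, layer-2 object V3 of
`Cruxes/EisensteinHeartFlatCMInertBadKPrime/LAYER2-VOCAB-BRIEF.md`).

* `ZpExtension.restrict κ L h` — the `ℤ_p`-extension `L·K_∞/L` of `L`, GIVEN the surjectivity `h` of `κ ∘ res`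
  (a definition with the proof obligation as an argument; nothing is asserted).
* `ZpExtension.restrict_apply` — `(κ.restrict L h) σ = κ (res σ)`.
* `ZpExtension.surjective_comp_absGaloisRestrict_of_finrank_eq_two` — for `[L : K] = 2`, `p ≠ 2`:
  `κ ∘ res` is surjective. Proof: `res(Γ_L) ≤ Γ_K` has index `[L : K] = 2`
  (`nat_card_quotient_range_absGaloisRestrict`), so its image `M ≤ ℤ_p` under the surjection `κ` has index
  dividing `2` (`Subgroup.index_map_dvd`), hence contains all squares (`Subgroup.pow_index_mem`); and in the
  additive group `ℤ_p` with `p` odd every element is twice another (`2 ∈ ℤ_p^×`), so `M = ℤ_p`.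
* `ZpExtension.restrictOfFinrankEqTwo` — the resulting `ℤ_p`-extension of `L`.

Statement/definition file: no `sorry`, no `instance`, no notation; docstring on every declaration.
References: [Washington1997] L. Washington, *Introduction to Cyclotomic Fields*, 2nd ed., §13.1 (ℤ_p-extensions,
`K_∞L/L`); [NeukirchANT1999] Ch. IV §1 (the index of `res(Γ_L)`). [folklore]
-/

noncomputable section

open scoped Classical

open Field Literature.NumberTheory.GaloisRepresentations

universe u v

namespace Literature.NumberTheory.EllipticCurves.ZpExtension

variable {K : Type u} [Field K] [NumberField K] {p : ℕ} [Fact p.Prime]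

/-- **Restriction of a `ℤ_p`-extension along `L/K`**: the continuous homomorphism
`κ ∘ res : Γ_L → Γ_K → ℤ_p`, packaged as a `ℤ_p`-extension of `L` given its surjectivity `h` (the field it cuts
out is `L·K_∞`). [cite: Washington1997, §13.1] -/
def restrict (κ : ZpExtension K p) (L : Type v) [Field L] [NumberField L] [Algebra K L]
    (h : Function.Surjective (κ.toContinuousMonoidHom.comp (absGaloisRestrict K L))) : ZpExtension L p :=
  ⟨κ.toContinuousMonoidHom.comp (absGaloisRestrict K L), h⟩

omit [NumberField K] in
/-- Unfolding `restrict`: `(κ.restrict L h) σ = κ (res σ)`. [cite: Washington1997, §13.1] -/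
@[simp]
theorem restrict_apply (κ : ZpExtension K p) (L : Type v) [Field L] [NumberField L] [Algebra K L]
    (h : Function.Surjective (κ.toContinuousMonoidHom.comp (absGaloisRestrict K L)))
    (σ : absoluteGaloisGroup L) : κ.restrict L h σ = κ (absGaloisRestrict K L σ) :=
  rfl

/-- In `ℤ_p` with `p` odd, `2` is a unit. [folklore] -/
private theorem isUnit_two_padicInt (hp : p ≠ 2) : IsUnit (2 : ℤ_[p]) := by
  rw [PadicInt.isUnit_iff]
  have hle : ‖(2 : ℤ_[p])‖ ≤ 1 := PadicInt.norm_le_one _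
  have hlt : ¬ ‖(2 : ℤ_[p])‖ < 1 := by
    intro h
    have h' : ‖((2 : ℤ) : ℤ_[p])‖ < 1 := by exact_mod_cast h
    rw [PadicInt.norm_int_lt_one_iff_dvd] at h'
    have : (p : ℤ) ∣ 2 := h'
    have hp2 : p ∣ 2 := by exact_mod_cast this
    exact hp ((Nat.prime_dvd_prime_iff_eq (Fact.out : p.Prime) Nat.prime_two).mp hp2)
  exact le_antisymm hle (not_lt.mp hlt)

/-- **A subgroup of `ℤ_p` (written multiplicatively) of index dividing `2` is everything, for `p` odd**:
it contains all squares (`g^{[ℤ_p : M]} ∈ M`), and every element of `ℤ_p` is a square (= twice another,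
additively) since `2 ∈ ℤ_p^×`. [folklore] -/
private theorem eq_top_of_index_dvd_two (hp : p ≠ 2) (M : Subgroup (Multiplicative ℤ_[p])) (hM : M.index ∣ 2) :
    M = ⊤ := by
  rcases (Nat.dvd_prime Nat.prime_two).mp hM with h1 | h2
  · exact Subgroup.index_eq_one.mp h1
  · rw [eq_top_iff]
    intro y _
    obtain ⟨u, hu⟩ := isUnit_two_padicInt (p := p) hp
    set b : ℤ_[p] := (↑u⁻¹ : ℤ_[p]) * Multiplicative.toAdd y with hb
    have hy : y = (Multiplicative.ofAdd b) ^ 2 := by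
      rw [← ofAdd_nsmul, hb, nsmul_eq_mul, Nat.cast_ofNat, ← mul_assoc, ← hu, Units.mul_inv, one_mul,
        ofAdd_toAdd]
    rw [hy, ← h2]
    exact Subgroup.pow_index_mem M _

/-- **`κ ∘ res : Γ_L → ℤ_p` is surjective when `[L : K] = 2` and `p ≠ 2`** (`L ∩ K_∞ = K` because
`Gal(K_∞/K) ≅ ℤ_p` has no quotient of order `2`): `res(Γ_L)` has index `[L : K] = 2` in `Γ_K`
(`nat_card_quotient_range_absGaloisRestrict`), its image under the surjection `κ` has index dividing `2`
(`Subgroup.index_map_dvd`), hence is all of `ℤ_p` (`eq_top_of_index_dvd_two`).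
[cite: Washington1997, §13.1] [cite: NeukirchANT1999, Ch. IV §1] -/
theorem surjective_comp_absGaloisRestrict_of_finrank_eq_two (hp : p ≠ 2) (κ : ZpExtension K p)
    (L : Type v) [Field L] [NumberField L] [Algebra K L] (hL : Module.finrank K L = 2) :
    Function.Surjective (κ.toContinuousMonoidHom.comp (absGaloisRestrict K L)) := by
  haveI : FiniteDimensional K L := Module.Finite.of_restrictScalars_finite ℚ K L
  set H : Subgroup (absoluteGaloisGroup K) := (absGaloisRestrict K L).range with hH
  set f : absoluteGaloisGroup K →* Multiplicative ℤ_[p] := κ.toContinuousMonoidHom.toMonoidHom with hf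
  have hHidx : H.index = 2 := by
    have h := nat_card_quotient_range_absGaloisRestrict K L
    rw [hL] at h
    exact h
  have hfs : Function.Surjective f := κ.surjective
  have hMidx : (H.map f).index ∣ 2 := hHidx ▸ Subgroup.index_map_dvd H hfs
  have hM : H.map f = ⊤ := eq_top_of_index_dvd_two hp _ hMidx
  intro y
  have hy : y ∈ H.map f := hM ▸ Subgroup.mem_top y
  obtain ⟨σ, ⟨τ, rfl⟩, hστ⟩ := Subgroup.mem_map.mp hy
  exact ⟨τ, hστ⟩

/-- **The `ℤ_p`-extension `L·K_∞/L` for `[L : K] = 2`, `p ≠ 2`** — `restrict` with the surjectivity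
discharged. In the BSD programme: the anticyclotomic `ℤ_p`-extension of a Heegner field `K′` lifted to the
biquadratic CM field `L = K′·K_CM`. [cite: Washington1997, §13.1] -/
def restrictOfFinrankEqTwo (hp : p ≠ 2) (κ : ZpExtension K p) (L : Type v) [Field L] [NumberField L]
    [Algebra K L] (hL : Module.finrank K L = 2) : ZpExtension L p :=
  κ.restrict L (surjective_comp_absGaloisRestrict_of_finrank_eq_two hp κ L hL)

/-- Unfolding `restrictOfFinrankEqTwo`: its value at `σ ∈ Γ_L` is `κ (res σ)`. [cite: Washington1997, §13.1] -/
@[simp]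
theorem restrictOfFinrankEqTwo_apply (hp : p ≠ 2) (κ : ZpExtension K p) (L : Type v) [Field L]
    [NumberField L] [Algebra K L] (hL : Module.finrank K L = 2) (σ : absoluteGaloisGroup L) :
    κ.restrictOfFinrankEqTwo hp L hL σ = κ (absGaloisRestrict K L σ) :=
  rfl

omit [NumberField K] in
/-- The kernel subgroup of the restricted extension is the preimage of `κ`'s kernel subgroup under `res`
(`Gal(L̄/L·K_∞) = res⁻¹ Gal(K̄/K_∞)`). [cite: Washington1997, §13.1] -/
theorem kerSubgroup_restrict (κ : ZpExtension K p) (L : Type v) [Field L] [NumberField L] [Algebra K L]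
    (h : Function.Surjective (κ.toContinuousMonoidHom.comp (absGaloisRestrict K L))) :
    (κ.restrict L h).kerSubgroup = κ.kerSubgroup.comap (absGaloisRestrict K L).toMonoidHom := by
  ext σ
  simp [mem_kerSubgroup, restrict_apply]

end Literature.NumberTheory.EllipticCurves.ZpExtension

end
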